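/-
Copyright (c) 2026 the pub-hodgecm-mathlib formalisation cell (harness21).  Prover seat hodgecm-mathlib-LH4-p09 (g8), req620 Track A «(D-RAM) FOUR-FRAME» squad
(heir LEAD F0P3a-plan (g20) T19-24 «STAGE-1b PRE-SCOPING BY IDLE HANDS: ALLOWED AS SCOPING»; dealer LH4-plan (g12)).  2026-09-04.
-/
import Summits.HodgeConjecture.HodgeConjecture.Theorems.F0P3cDyRamDiagonalStableLatticeHNF   -- ★ (LH4-p12 (g2)): `mulVec_hnf`, `mem_latt_hnf_iff`, `forall_mem_latt_mulVec_mem_iff_columns`, `mapGL_diagonal_latt_hnf_eq_iff`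
import Summits.HodgeConjecture.HodgeConjecture.Theorems.F0P3cDyRamFourFrameCensusDefs        -- ★ U2G DEFS LEAF (B-p08 (g41)): `LatticeInLevel`
import HarnessLib

/-!
# Crux `H413`, line LH4 «(D-RAM) FOUR-FRAME» road — STAGE-1b SCOPING BRICK «(L-model-H)»: THE DIAGONAL LEVEL TOKEN ON AN HNF LATTICE IN CLOSED FORM
# (the level-token twin of ★ `F0P3cDyRamDiagonalStableLatticeHNF.mapGL_diagonal_latt_hnf_eq_iff` — the «label read» of every labelled Stage-B stratum)

Cell `hodgecm-mathlib` (D-0151), FLOOR 0, crux item H413 = `stmt-HodgeConjecture-24833`, route of record `HCCMUnconditional`; squad F0∕P3c∕LH4 (req618∕req620).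
THEOREMS ONLY (no `def`, no instance, no notation, no `sorry`, default heartbeats); lane `--supports stmt-HodgeConjecture-24833 --as helper` (count-neutral).
Consumers: the labelled Stage-B tables of the STAGE-1b level laws.  After ★ p858764 ∕ p858861 ∕ p858820 ∕ p858900 (this seat) a type-(1) level law of a four-frame family is a
statement `Σᶠ_{M₀ ∈ 𝓛₀(diag(α,β,1)), D₁M₀ ⊆ ϖ^aM₀ ∧ D₂M₀ ⊆ ϖ^{c′}M₀} (weight) = ‹closed form›` with DIAGONAL operators `D₁ = diag(α−1, β−1, 0)`, `D₂ = D₁²`; the ★ Stage-B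
pattern (`F0P3cDyRamStableCountTypeZero`, B3∕B4∕T1–T3∕G1–G3∕H) evaluates such sums stratum by stratum on the HNF lattices `V·𝒪³`, `V = [[1,0,0],[x,p,0],[y,z,r]]` (`p = ϖ^b`,
`r = ϖ^c`), where ★ `mapGL_diagonal_latt_hnf_eq_iff` reads `T`-stability off `x, y, z`.  This file reads the LEVEL TOKEN `diag(e)·(V𝒪³) ⊆ ϖ^ℓ·(V𝒪³)` the same way.

THE MATHEMATICS ([Serre1980Trees, Ch. II §1.1]; [Kottwitz1986BaseChangeUnits, §1 pp. 240–241]; [Laumon1995, Lemma (5.3.2)]).  `diag(e)·M ⊆ ϖ^ℓ·M` iff `M` is stable under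
`Y = ϖ^{−ℓ}·diag(e)` (§1; ★ `map_sub_one_le_scaleLattice_iff_map_shift_le` at `δ = diag(e) + 1`), iff `Y` maps the three columns `(1,x,y)`, `(0,p,z)`, `(0,0,r)` of `V` into `V·𝒪³`
(★ `forall_mem_latt_mulVec_mem_iff_columns`), iff — by ★ `mem_latt_hnf_iff` (forward substitution) — the six valuation inequalities
`|e₀|, |e₁|, |e₂| ≤ |ϖ^ℓ|`, `|(e₁ − e₀)·x| ≤ |ϖ^ℓ·p|`, `|(e₂ − e₁)·z| ≤ |ϖ^ℓ·r|`, `|(e₂ − e₀)·y·p + (e₀ − e₁)·x·z| ≤ |ϖ^ℓ·p·r|` hold (§2).  So the level label of a diagonal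
operator is an ORDER condition on the glue data `(x, y, z)` of the stratum, of the same shape as ★'s stability criterion with `(s_i − s_j)` replaced by `(e_i − e_j)` and every
threshold deepened by `ℓ` — plus the three absolute bounds `|e_i| ≤ |ϖ^ℓ|` (absent for `T`-stability, where the `s_i` are units).
* §1 `map_toLin'_le_iff_forall_mulVec_mem`, `latticeInLevel_iff_map_smul_le`, `latticeInLevel_iff_forall_smul_mulVec_mem` (any matrix, any lattice).
* §2 `v_inv_mul_le_iff`, `v_mul_le_mul_iff_of_ne_zero` (valuation bookkeeping); HEAD `latticeInLevel_diagonal_latt_hnf_iff`; the `(p, r) = (ϖ^b, ϖ^c)` exponent form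
  `latticeInLevel_diagonal_latt_hnf_pow_iff`.
HONEST LABEL.  Count-neutral (`--supports`); triangular linear algebra, nothing printed is asserted; pays NO tier-0 row; no Stage-B table is computed here; the census laws stay
PROVER TARGETS; `HC_CM` is proved only modulo the 7 printed citations (2 remaining named inputs: hLiu418 = `stmt-HodgeConjecture-24832`, h413 = `stmt-HodgeConjecture-24833`)
until rung 0 closes.

## References
* [Serre1980Trees] J.-P. Serre, *Trees*, Springer (1980), Ch. II §1.1 (lattices and their Hermite normal forms).
* [Kottwitz1986BaseChangeUnits] R. E. Kottwitz, *Base change for unit elements of Hecke algebras*, Compositio Math. 60 (1986), §1 pp. 240–241 (congruence conditions on lattices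
  fixed by a torus element).
* [Laumon1995] G. Laumon, *Cohomology of Drinfeld Modular Varieties I* (1996), Lemma (5.3.2) p. 136 (orbital integrals as lattice counts; triangular decomposition).
-/

set_option autoImplicit false

noncomputable section

namespace Summit.HodgeConjecture.HodgeConjecture.Cruxes.H413.F0P3cDyRamLevelTokenHNF

open Literature.NumberTheory.Automorphic Literature.NumberTheory.Automorphic.HermitianLattice
open Literature.NumberTheory.Automorphic.UnitaryLatticeTree
open Summit.HodgeConjecture.HodgeConjecture.Cruxes.H413.F0P3cDyRamDiagonalStableLatticeHNF
open Summit.HodgeConjecture.HodgeConjecture.Cruxes.H413.F0P3cDyRamFourFrameCensusDefs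
open scoped Valued WithZero Matrix MatrixGroups

variable {K : Type*} [Field K] [Valued K ℤᵐ⁰]

/-! ## §1  The level token as stability under the shifted operator, pointwise -/

/-- Stability under a matrix, pointwise: `Y·M ⊆ M ↔ ∀ w ∈ M, Y w ∈ M`. [cite: Serre1980Trees, Ch. II §1.1] -/
theorem map_toLin'_le_iff_forall_mulVec_mem {N : ℕ} (Y : Matrix (Fin N) (Fin N) K) (M : Submodule 𝒪[K] (Fin N → K)) :
    M.map ((Matrix.toLin' Y).restrictScalars 𝒪[K]) ≤ M ↔ ∀ w ∈ M, Y *ᵥ w ∈ M := by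
  constructor
  · intro h w hw
    exact h (Submodule.mem_map.2 ⟨w, hw, by rw [LinearMap.restrictScalars_apply, Matrix.toLin'_apply]⟩)
  · intro h v hv
    obtain ⟨w, hw, rfl⟩ := Submodule.mem_map.1 hv
    rw [LinearMap.restrictScalars_apply, Matrix.toLin'_apply]
    exact h w hw

/-- **THE LEVEL TOKEN IS STABILITY UNDER THE SHIFTED OPERATOR**: `X·M ⊆ ϖ^ℓ·M ↔ (ϖ^{−ℓ}·X)·M ⊆ M` (★ `map_sub_one_le_scaleLattice_iff_map_shift_le` at `δ = X + 1`; `ϖ ≠ 0`).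
[cite: Kottwitz1986BaseChangeUnits, §1 pp. 240–241] -/
theorem latticeInLevel_iff_map_smul_le {ϖ : K} (hϖ : ϖ ≠ 0) (ℓ : ℕ) (X : Matrix (Fin 3) (Fin 3) K) (M : Submodule 𝒪[K] (Fin 3 → K)) :
    LatticeInLevel ϖ ℓ X M ↔ M.map ((Matrix.toLin' ((ϖ ^ ℓ)⁻¹ • X)).restrictScalars 𝒪[K]) ≤ M := by
  have h := map_sub_one_le_scaleLattice_iff_map_shift_le (pow_ne_zero ℓ hϖ) (X + 1) M
  rw [add_sub_cancel_right] at h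
  unfold LatticeInLevel
  exact h

/-- The level token, pointwise: `X·M ⊆ ϖ^ℓ·M ↔ ∀ w ∈ M, (ϖ^{−ℓ}·X) w ∈ M`. [cite: Kottwitz1986BaseChangeUnits, §1 pp. 240–241] -/
theorem latticeInLevel_iff_forall_smul_mulVec_mem {ϖ : K} (hϖ : ϖ ≠ 0) (ℓ : ℕ) (X : Matrix (Fin 3) (Fin 3) K) (M : Submodule 𝒪[K] (Fin 3 → K)) :
    LatticeInLevel ϖ ℓ X M ↔ ∀ w ∈ M, ((ϖ ^ ℓ)⁻¹ • X) *ᵥ w ∈ M := by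
  rw [latticeInLevel_iff_map_smul_le hϖ, map_toLin'_le_iff_forall_mulVec_mem]

/-! ## §2  The diagonal level token on the HNF lattice `V·𝒪³`, `V = [[1,0,0],[x,p,0],[y,z,r]]` -/

/-- `|c⁻¹·t| ≤ |q| ↔ |t| ≤ |c·q|` (`c ≠ 0`). [cite: Serre1980Trees, Ch. II §1.1] -/
theorem v_inv_mul_le_iff {c : K} (hc : c ≠ 0) (t q : K) : Valued.v (c⁻¹ * t) ≤ Valued.v q ↔ Valued.v t ≤ Valued.v (c * q) := by
  have hvc : 0 < Valued.v c := (Valuation.pos_iff _).2 hc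
  rw [map_mul, map_inv₀, map_mul]
  exact inv_mul_le_iff₀ hvc

/-- `|t·p| ≤ |q·p| ↔ |t| ≤ |q|` (`p ≠ 0`). [cite: Serre1980Trees, Ch. II §1.1] -/
theorem v_mul_le_mul_iff_of_ne_zero {p : K} (hp : p ≠ 0) (t q : K) : Valued.v (t * p) ≤ Valued.v (q * p) ↔ Valued.v t ≤ Valued.v q := by
  have hvp : 0 < Valued.v p := (Valuation.pos_iff _).2 hp
  rw [map_mul, map_mul]
  exact mul_le_mul_iff_left₀ hvp

/-- **HEAD — THE DIAGONAL LEVEL TOKEN ON THE HNF LATTICE IN CLOSED FORM.**  For `V = [[1,0,0],[x,p,0],[y,z,r]]` with `p, r ≠ 0`, `ϖ ≠ 0`, any diagonal operator `diag(e)` and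
any level `ℓ`:  `diag(e)·(V𝒪³) ⊆ ϖ^ℓ·(V𝒪³)` iff
`|e₀| ≤ |ϖ^ℓ| ∧ |e₁| ≤ |ϖ^ℓ| ∧ |e₂| ≤ |ϖ^ℓ| ∧ |(e₁ − e₀)·x| ≤ |ϖ^ℓ·p| ∧ |(e₂ − e₁)·z| ≤ |ϖ^ℓ·r| ∧ |(e₂ − e₀)·y·p + (e₀ − e₁)·x·z| ≤ |ϖ^ℓ·(p·r)|`
— the operator `ϖ^{−ℓ}diag(e)` applied to the columns `(1,x,y)`, `(0,p,z)`, `(0,0,r)` and read back through forward substitution (★ `mem_latt_hnf_iff`).  Compare ★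
`mapGL_diagonal_latt_hnf_eq_iff` (`T = diag(s)`-stability: the same three mixed inequalities at `ℓ = 0` with `e = s`, no absolute bounds since `|s_i| = 1`).
[cite: Serre1980Trees, Ch. II §1.1] [cite: Kottwitz1986BaseChangeUnits, §1 pp. 240–241] [cite: Laumon1995, Lemma (5.3.2) p. 136] -/
theorem latticeInLevel_diagonal_latt_hnf_iff {ϖ : K} (hϖ : ϖ ≠ 0) (ℓ : ℕ) (e : Fin 3 → K) (x y z : K) {p r : K} (hp : p ≠ 0) (hr : r ≠ 0) :
    LatticeInLevel ϖ ℓ (Matrix.diagonal e) (latt (Matrix.of ![![1, 0, 0], ![x, p, 0], ![y, z, r]])) ↔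
      Valued.v (e 0) ≤ Valued.v (ϖ ^ ℓ) ∧ Valued.v (e 1) ≤ Valued.v (ϖ ^ ℓ) ∧ Valued.v (e 2) ≤ Valued.v (ϖ ^ ℓ) ∧
        Valued.v ((e 1 - e 0) * x) ≤ Valued.v (ϖ ^ ℓ * p) ∧ Valued.v ((e 2 - e 1) * z) ≤ Valued.v (ϖ ^ ℓ * r) ∧
          Valued.v ((e 2 - e 0) * y * p + (e 0 - e 1) * x * z) ≤ Valued.v (ϖ ^ ℓ * (p * r)) := by
  have hc : (ϖ ^ ℓ : K) ≠ 0 := pow_ne_zero ℓ hϖ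
  have hpr : p * r ≠ 0 := mul_ne_zero hp hr
  rw [latticeInLevel_iff_forall_smul_mulVec_mem hϖ, forall_mem_latt_mulVec_mem_iff_columns]
  -- the three columns and their images under `ϖ^{−ℓ}·diag(e)`
  have hc0 : ((ϖ ^ ℓ)⁻¹ • Matrix.diagonal e) *ᵥ ((Matrix.of ![![1, 0, 0], ![x, p, 0], ![y, z, r]]) *ᵥ (Pi.single 0 1)) =
      ![(ϖ ^ ℓ)⁻¹ * e 0, (ϖ ^ ℓ)⁻¹ * (e 1 * x), (ϖ ^ ℓ)⁻¹ * (e 2 * y)] := by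
    rw [mulVec_hnf, Matrix.smul_mulVec]
    ext i; fin_cases i <;> simp [Matrix.mulVec_diagonal]
  have hc1 : ((ϖ ^ ℓ)⁻¹ • Matrix.diagonal e) *ᵥ ((Matrix.of ![![1, 0, 0], ![x, p, 0], ![y, z, r]]) *ᵥ (Pi.single 1 1)) =
      ![0, (ϖ ^ ℓ)⁻¹ * (e 1 * p), (ϖ ^ ℓ)⁻¹ * (e 2 * z)] := by
    rw [mulVec_hnf, Matrix.smul_mulVec]
    ext i; fin_cases i <;> simp [Matrix.mulVec_diagonal]
  have hc2 : ((ϖ ^ ℓ)⁻¹ • Matrix.diagonal e) *ᵥ ((Matrix.of ![![1, 0, 0], ![x, p, 0], ![y, z, r]]) *ᵥ (Pi.single 2 1)) =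
      ![0, 0, (ϖ ^ ℓ)⁻¹ * (e 2 * r)] := by
    rw [mulVec_hnf, Matrix.smul_mulVec]
    ext i; fin_cases i <;> simp [Matrix.mulVec_diagonal]
  -- column 0: the bound on `e₀` and the two mixed inequalities
  have m0 : ((ϖ ^ ℓ)⁻¹ • Matrix.diagonal e) *ᵥ ((Matrix.of ![![1, 0, 0], ![x, p, 0], ![y, z, r]]) *ᵥ (Pi.single 0 1)) ∈
        latt (Matrix.of ![![1, 0, 0], ![x, p, 0], ![y, z, r]]) ↔
      Valued.v (e 0) ≤ Valued.v (ϖ ^ ℓ) ∧ Valued.v ((e 1 - e 0) * x) ≤ Valued.v (ϖ ^ ℓ * p) ∧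
        Valued.v ((e 2 - e 0) * y * p + (e 0 - e 1) * x * z) ≤ Valued.v (ϖ ^ ℓ * (p * r)) := by
    rw [hc0, mem_latt_hnf_iff x y z hp hr]
    have e00 : (![(ϖ ^ ℓ)⁻¹ * e 0, (ϖ ^ ℓ)⁻¹ * (e 1 * x), (ϖ ^ ℓ)⁻¹ * (e 2 * y)] : Fin 3 → K) 0 = (ϖ ^ ℓ)⁻¹ * e 0 := rfl
    have e01 : (![(ϖ ^ ℓ)⁻¹ * e 0, (ϖ ^ ℓ)⁻¹ * (e 1 * x), (ϖ ^ ℓ)⁻¹ * (e 2 * y)] : Fin 3 → K) 1 -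
        x * (![(ϖ ^ ℓ)⁻¹ * e 0, (ϖ ^ ℓ)⁻¹ * (e 1 * x), (ϖ ^ ℓ)⁻¹ * (e 2 * y)] : Fin 3 → K) 0 = (ϖ ^ ℓ)⁻¹ * ((e 1 - e 0) * x) := by
      simp; ring
    have e02 : ((![(ϖ ^ ℓ)⁻¹ * e 0, (ϖ ^ ℓ)⁻¹ * (e 1 * x), (ϖ ^ ℓ)⁻¹ * (e 2 * y)] : Fin 3 → K) 2 -
          y * (![(ϖ ^ ℓ)⁻¹ * e 0, (ϖ ^ ℓ)⁻¹ * (e 1 * x), (ϖ ^ ℓ)⁻¹ * (e 2 * y)] : Fin 3 → K) 0) * p -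
        z * ((![(ϖ ^ ℓ)⁻¹ * e 0, (ϖ ^ ℓ)⁻¹ * (e 1 * x), (ϖ ^ ℓ)⁻¹ * (e 2 * y)] : Fin 3 → K) 1 -
          x * (![(ϖ ^ ℓ)⁻¹ * e 0, (ϖ ^ ℓ)⁻¹ * (e 1 * x), (ϖ ^ ℓ)⁻¹ * (e 2 * y)] : Fin 3 → K) 0) =
        (ϖ ^ ℓ)⁻¹ * ((e 2 - e 0) * y * p + (e 0 - e 1) * x * z) := by
      simp; ring
    rw [e02, e01, e00, show (1 : ℤᵐ⁰) = Valued.v (1 : K) from (map_one _).symm, v_inv_mul_le_iff hc, mul_one,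
      v_inv_mul_le_iff hc, v_inv_mul_le_iff hc]
  -- column 1: the bound on `e₁` and the `z`-inequality
  have m1 : ((ϖ ^ ℓ)⁻¹ • Matrix.diagonal e) *ᵥ ((Matrix.of ![![1, 0, 0], ![x, p, 0], ![y, z, r]]) *ᵥ (Pi.single 1 1)) ∈
        latt (Matrix.of ![![1, 0, 0], ![x, p, 0], ![y, z, r]]) ↔
      Valued.v (e 1) ≤ Valued.v (ϖ ^ ℓ) ∧ Valued.v ((e 2 - e 1) * z) ≤ Valued.v (ϖ ^ ℓ * r) := by
    rw [hc1, mem_latt_hnf_iff x y z hp hr]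
    have e10 : (![0, (ϖ ^ ℓ)⁻¹ * (e 1 * p), (ϖ ^ ℓ)⁻¹ * (e 2 * z)] : Fin 3 → K) 0 = 0 := rfl
    have e11 : (![0, (ϖ ^ ℓ)⁻¹ * (e 1 * p), (ϖ ^ ℓ)⁻¹ * (e 2 * z)] : Fin 3 → K) 1 -
        x * (![0, (ϖ ^ ℓ)⁻¹ * (e 1 * p), (ϖ ^ ℓ)⁻¹ * (e 2 * z)] : Fin 3 → K) 0 = (ϖ ^ ℓ)⁻¹ * (e 1 * p) := by
      simp
    have e12 : ((![0, (ϖ ^ ℓ)⁻¹ * (e 1 * p), (ϖ ^ ℓ)⁻¹ * (e 2 * z)] : Fin 3 → K) 2 -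
          y * (![0, (ϖ ^ ℓ)⁻¹ * (e 1 * p), (ϖ ^ ℓ)⁻¹ * (e 2 * z)] : Fin 3 → K) 0) * p -
        z * ((![0, (ϖ ^ ℓ)⁻¹ * (e 1 * p), (ϖ ^ ℓ)⁻¹ * (e 2 * z)] : Fin 3 → K) 1 -
          x * (![0, (ϖ ^ ℓ)⁻¹ * (e 1 * p), (ϖ ^ ℓ)⁻¹ * (e 2 * z)] : Fin 3 → K) 0) =
        (ϖ ^ ℓ)⁻¹ * ((e 2 - e 1) * z * p) := by
      simp; ring
    rw [e12, e11, e10, map_zero, v_inv_mul_le_iff hc, v_inv_mul_le_iff hc,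
      show ϖ ^ ℓ * (p * r) = ϖ ^ ℓ * r * p by ring, v_mul_le_mul_iff_of_ne_zero hp, v_mul_le_mul_iff_of_ne_zero hp]
    exact ⟨fun h => ⟨h.2.1, h.2.2⟩, fun h => ⟨zero_le, h.1, h.2⟩⟩
  -- column 2: the bound on `e₂`
  have m2 : ((ϖ ^ ℓ)⁻¹ • Matrix.diagonal e) *ᵥ ((Matrix.of ![![1, 0, 0], ![x, p, 0], ![y, z, r]]) *ᵥ (Pi.single 2 1)) ∈
        latt (Matrix.of ![![1, 0, 0], ![x, p, 0], ![y, z, r]]) ↔ Valued.v (e 2) ≤ Valued.v (ϖ ^ ℓ) := by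
    rw [hc2, mem_latt_hnf_iff x y z hp hr]
    have e20 : (![0, 0, (ϖ ^ ℓ)⁻¹ * (e 2 * r)] : Fin 3 → K) 0 = 0 := rfl
    have e21 : (![0, 0, (ϖ ^ ℓ)⁻¹ * (e 2 * r)] : Fin 3 → K) 1 - x * (![0, 0, (ϖ ^ ℓ)⁻¹ * (e 2 * r)] : Fin 3 → K) 0 = 0 := by simp
    have e22 : ((![0, 0, (ϖ ^ ℓ)⁻¹ * (e 2 * r)] : Fin 3 → K) 2 - y * (![0, 0, (ϖ ^ ℓ)⁻¹ * (e 2 * r)] : Fin 3 → K) 0) * p -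
        z * ((![0, 0, (ϖ ^ ℓ)⁻¹ * (e 2 * r)] : Fin 3 → K) 1 - x * (![0, 0, (ϖ ^ ℓ)⁻¹ * (e 2 * r)] : Fin 3 → K) 0) =
        (ϖ ^ ℓ)⁻¹ * (e 2 * (p * r)) := by
      simp; ring
    rw [e22, e21, e20, v_inv_mul_le_iff hc, v_mul_le_mul_iff_of_ne_zero hpr, map_zero]
    exact ⟨fun h => h.2.2, fun h => ⟨zero_le, zero_le, h⟩⟩
  constructor
  · intro h
    exact ⟨(m0.1 (h 0)).1, (m1.1 (h 1)).1, m2.1 (h 2), (m0.1 (h 0)).2.1, (m1.1 (h 1)).2, (m0.1 (h 0)).2.2⟩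
  · rintro ⟨h0, h1, h2, h3, h4, h5⟩ j
    fin_cases j
    · exact m0.2 ⟨h0, h3, h5⟩
    · exact m1.2 ⟨h1, h4⟩
    · exact m2.2 h2

/-- **EXPONENT FORM** (`p = ϖ^b`, `r = ϖ^c`, the ★ strata currency): `diag(e)·(V𝒪³) ⊆ ϖ^ℓ·(V𝒪³)` iff `|e_i| ≤ |ϖ|^ℓ` (`i = 0, 1, 2`), `|(e₁ − e₀)·x| ≤ |ϖ|^{ℓ+b}`,
`|(e₂ − e₁)·z| ≤ |ϖ|^{ℓ+c}` and `|(e₂ − e₀)·y·ϖ^b + (e₀ − e₁)·x·z| ≤ |ϖ|^{ℓ+b+c}`. [cite: Serre1980Trees, Ch. II §1.1] [cite: Kottwitz1986BaseChangeUnits, §1 pp. 240–241] -/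
theorem latticeInLevel_diagonal_latt_hnf_pow_iff {ϖ : K} (hϖ : ϖ ≠ 0) (ℓ b c : ℕ) (e : Fin 3 → K) (x y z : K) :
    LatticeInLevel ϖ ℓ (Matrix.diagonal e) (latt (Matrix.of ![![1, 0, 0], ![x, ϖ ^ b, 0], ![y, z, ϖ ^ c]])) ↔
      Valued.v (e 0) ≤ Valued.v ϖ ^ ℓ ∧ Valued.v (e 1) ≤ Valued.v ϖ ^ ℓ ∧ Valued.v (e 2) ≤ Valued.v ϖ ^ ℓ ∧
        Valued.v ((e 1 - e 0) * x) ≤ Valued.v ϖ ^ (ℓ + b) ∧ Valued.v ((e 2 - e 1) * z) ≤ Valued.v ϖ ^ (ℓ + c) ∧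
          Valued.v ((e 2 - e 0) * y * ϖ ^ b + (e 0 - e 1) * x * z) ≤ Valued.v ϖ ^ (ℓ + b + c) := by
  rw [latticeInLevel_diagonal_latt_hnf_iff hϖ ℓ e x y z (pow_ne_zero b hϖ) (pow_ne_zero c hϖ)]
  simp only [← pow_add, map_pow, add_assoc]

end Summit.HodgeConjecture.HodgeConjecture.Cruxes.H413.F0P3cDyRamLevelTokenHNF

end
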